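import Summits.Ventures.PercRepro.RankLevelSetCircuitCount
import Summits.Ventures.PercRepro.RankLevelSetCountBounds
import Summits.Ventures.PercRepro.MatroidColoopStepA

/-!
# PercRepro — THE `U`-COUNT AT LEVEL `4` AND BOUNDED CORANK ON THE `e`-FREE CORE (night-1, gen 4)

`proofs/NIGHT-1-C025-induction.md` §15. For the level-`4` inequality at corank `d = |E| − r(M)` the sets to count are
the complements `B = E ∖ A` of the members `A` of `U(p, 4)`: `A` is spanning, so `B` is coindependent and has at most
`d` elements (`topCount_le_ncard_compl`), and `r(B) = 4`. A rank-`4` set with MORE than `4` elements is dependent,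
hence of the form `C ∪ B' ∪ Z` with `C` a circuit of `3`, `4` or `5` elements, `B'` disjoint from `C` with
`|C| + |B'| = 5`, and `Z` inside `cl(C ∪ B') ∖ (C ∪ B')` — a set of at most `10 − 5 = 5` points when every rank-`≤ 4`
set has `≤ 10` points (the `e`-free core, `ncard_le_ten_of_eRk_le_four_of_free`) — with `|Z| ≤ d − 5`
(`exists_circuit_extension_exact`, `ncard_fibre_le`). Hence

  `#{B ⊆ E : r(B) = 4, |B| ≤ d} ≤ C(n, 4) + σ(d) · (s₃ · C(n, 2) + s₄ · n + s₅)`,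
  `σ(d) = Σ_{j ≤ d − 5} C(5, j)`, `s_k = #{k-element circuits}` (`ncard_eRk_eq_four_ncard_le_le`),

and `s_k ≤ C(d + k − 1, k)` by `ncard_circuits_le_choose`. Axioms: standard.
-/

open scoped Matroid

namespace PercRepro

namespace Matroid

open Set

variable {α : Type} {M : _root_.Matroid α}

/-- **The members of `U(p, q)` have coindependent complements**: when `r(M) = p` and `|E| = r(M) + d`, the map
`A ↦ E ∖ A` injects `U(p, q)` into the sets `B ⊆ E` of rank `q` with at most `d` elements. -/
theorem topCount_le_ncard_compl [M.Finite] {p d : ℕ} (hR : M.eRank = (p : ℕ∞))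
    (hd : M.E.encard = M.eRank + d) (q : ℕ) :
    topCount M p q ≤ {B : Set α | B ⊆ M.E ∧ M.eRk B = q ∧ B.ncard ≤ d}.ncard := by
  classical
  have hν : M✶.eRank = (d : ℕ∞) := by
    have h := _root_.Matroid.eRank_add_eRank_dual M
    rw [hd] at h
    exact WithTop.add_left_cancel (eRank_ne_top_of_finite M) h
  unfold topCount
  have hmaps : ∀ A ∈ {A : Set α | A ⊆ M.E ∧ M.eRk A = (p : ℕ∞) ∧ M.eRk (M.E \ A) = (q : ℕ∞)},
      M.E \ A ∈ {B : Set α | B ⊆ M.E ∧ M.eRk B = q ∧ B.ncard ≤ d} := by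
    intro A hA
    refine ⟨sdiff_subset, hA.2.2, ?_⟩
    have hsp : M.Spanning A := by
      rw [_root_.Matroid.spanning_iff_eRk_le']
      exact ⟨by rw [hR, hA.2.1], hA.1⟩
    have hco : M.Coindep (M.E \ A) := by
      rw [_root_.Matroid.coindep_iff_compl_spanning sdiff_subset, sdiff_sdiff_cancel_left hA.1]
      exact hsp
    have hind : M✶.Indep (M.E \ A) := _root_.Matroid.coindep_def.1 hco
    have h := hind.encard_le_eRank
    rw [hν, ← (M.ground_finite.sdiff).cast_ncard_eq] at h
    exact_mod_cast h
  have hinj : InjOn (fun A => M.E \ A)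
      {A : Set α | A ⊆ M.E ∧ M.eRk A = (p : ℕ∞) ∧ M.eRk (M.E \ A) = (q : ℕ∞)} := by
    intro A hA A' hA' h
    simp only at h
    rw [← sdiff_sdiff_cancel_left hA.1, h, sdiff_sdiff_cancel_left hA'.1]
  exact ncard_le_ncard_of_injOn (fun A => M.E \ A) hmaps hinj
    (M.ground_finite.finite_subsets.subset (fun B hB => hB.1))

/-- **The exact structure of a dense rank-`q` set**: if `X ⊆ E` has rank `q` and more than `q` elements, there are a circuit `C ⊆ X` and `B' ⊆ X` disjoint from `C` with `|C| + |B'| = q + 1` and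
`X ⊆ cl(C ∪ B')`. -/
theorem exists_circuit_extension_exact [M.Finite]
    {X : Set α} (hX : X ⊆ M.E) {q : ℕ} (hq : M.eRk X = q) (hdense : q < X.ncard) :
    ∃ C B' : Set α, M.IsCircuit C ∧ C ⊆ X ∧ B' ⊆ X ∧ Disjoint B' C ∧ C.ncard + B'.ncard = q + 1 ∧
      X ⊆ M.closure (C ∪ B') := by
  have hXfin : X.Finite := M.ground_finite.subset hX
  have hdep : M.Dep X := by
    refine ⟨fun hind => ?_, hX⟩
    rw [hind.eRk_eq_encard, ← hXfin.cast_ncard_eq] at hq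
    have : X.ncard = q := by exact_mod_cast hq
    omega
  obtain ⟨C, hCX, hC⟩ := hdep.exists_isCircuit_subset
  obtain ⟨c, hc⟩ := hC.nonempty
  have hCfin : C.Finite := hXfin.subset hCX
  have hind : M.Indep (C \ {c}) := hC.sdiff_singleton_indep hc
  obtain ⟨B, hB, hCB⟩ := hind.subset_isBasis_of_subset (sdiff_subset.trans hCX) hX
  have hBfin : B.Finite := hXfin.subset hB.subset
  have hBcard : B.ncard = q := by
    have h := hB.encard_eq_eRk
    rw [hq, ← hBfin.cast_ncard_eq] at h
    exact_mod_cast h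
  -- `c ∉ B`: otherwise `C ⊆ B` would be dependent
  have hcB : c ∉ B := by
    intro hcB
    have hCB' : C ⊆ B := by
      intro x hx
      by_cases hxc : x = c
      · rw [hxc]; exact hcB
      · exact hCB ⟨hx, hxc⟩
    exact hC.dep.not_indep (hB.indep.subset hCB')
  -- `B ∩ C = C ∖ {c}`
  have hBC : B ∩ C = C \ {c} := by
    ext x
    constructor
    · rintro ⟨hxB, hxC⟩
      exact ⟨hxC, fun hxc => hcB (mem_singleton_iff.1 hxc ▸ hxB)⟩
    · intro hx
      exact ⟨hCB hx, hx.1⟩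
  refine ⟨C, B \ C, hC, hCX, sdiff_subset.trans hB.subset, disjoint_sdiff_left, ?_, ?_⟩
  · have h1 := ncard_inter_add_ncard_sdiff_eq_ncard B C hBfin
    have h2 := ncard_sdiff_singleton_add_one hc hCfin
    rw [hBC, hBcard] at h1
    omega
  · have hBsub : B ⊆ C ∪ (B \ C) := by
      intro x hx
      by_cases hxC : x ∈ C
      · exact Or.inl hxC
      · exact Or.inr ⟨hx, hxC⟩
    exact hB.subset_closure.trans (M.closure_subset_closure hBsub)

/-- **The fibre count.** If `|U| = 5` and `|F ∖ U| ≤ 5`, the sets `B` with `U ⊆ B ⊆ F` and `|B| ≤ d`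
number at most `σ(d) = Σ_{j ≤ d − 5} C(5, j)` (`B ↦ B ∖ U` injects them into the subsets of `F ∖ U` of size
`≤ d − 5`). -/
theorem ncard_fibre_le {U F : Set α} (hF : F.Finite) (hU : U.ncard = 5)
    (hFU : (F \ U).ncard ≤ 5) (d : ℕ) :
    {B : Set α | U ⊆ B ∧ B ⊆ F ∧ B.ncard ≤ d}.ncard ≤ ∑ j ∈ Finset.range (d - 5 + 1), Nat.choose 5 j := by
  classical
  have hFUfin : (F \ U).Finite := hF.subset sdiff_subset
  set T := hFUfin.toFinset with hT
  have hTcoe : (T : Set α) = F \ U := Set.Finite.coe_toFinset _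
  have hTcard : T.card ≤ 5 := by
    rw [← Set.ncard_eq_toFinset_card _ hFUfin]; exact hFU
  have hmaps : ∀ B ∈ {B : Set α | U ⊆ B ∧ B ⊆ F ∧ B.ncard ≤ d},
      B \ U ∈ {Z : Set α | Z ⊆ (T : Set α) ∧ Z.ncard ≤ d - 5} := by
    intro B hB
    have hBfin : B.Finite := hF.subset hB.2.1
    refine ⟨by rw [hTcoe]; exact sdiff_subset_sdiff_left hB.2.1, ?_⟩
    rw [ncard_sdiff hB.1 (hBfin.subset hB.1), hU]
    have := hB.2.2
    omega
  have hinj : InjOn (fun B => B \ U) {B : Set α | U ⊆ B ∧ B ⊆ F ∧ B.ncard ≤ d} := by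
    intro B hB B' hB' h
    simp only at h
    rw [← union_sdiff_cancel hB.1, h, union_sdiff_cancel hB'.1]
  calc {B : Set α | U ⊆ B ∧ B ⊆ F ∧ B.ncard ≤ d}.ncard
      ≤ {Z : Set α | Z ⊆ (T : Set α) ∧ Z.ncard ≤ d - 5}.ncard :=
        ncard_le_ncard_of_injOn (fun B => B \ U) hmaps hinj
          ((T.finite_toSet.finite_subsets).subset (fun Z hZ => hZ.1))
    _ ≤ ∑ j ∈ Finset.range (d - 5 + 1), T.card.choose j := ncard_subsets_ncard_le T (d - 5)
    _ ≤ ∑ j ∈ Finset.range (d - 5 + 1), Nat.choose 5 j := by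
        apply Finset.sum_le_sum
        intro j _
        exact Nat.choose_le_choose j hTcard

/-- **THE RANK-`4` SETS OF AT MOST `d` ELEMENTS**, when every circuit has `≥ 3` elements and every set of rank `≤ 4`
has `≤ 10` elements: `#{B ⊆ E : r(B) = 4, |B| ≤ d} ≤ C(n, 4) + σ(d)·(s₃·C(n, 2) + s₄·n + s₅)` with
`σ(d) = Σ_{j ≤ d−5} C(5, j)` and `s_k` the number of `k`-element circuits. -/
theorem ncard_eRk_eq_four_ncard_le_le (M : _root_.Matroid α) [M.Finite]
    (hcirc : ∀ C, M.IsCircuit C → 3 ≤ C.encard)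
    (hten : ∀ X ⊆ M.E, M.eRk X ≤ 4 → X.ncard ≤ 10) (d : ℕ) :
    {B : Set α | B ⊆ M.E ∧ M.eRk B = 4 ∧ B.ncard ≤ d}.ncard ≤
      M.E.ncard.choose 4 +
        (∑ j ∈ Finset.range (d - 5 + 1), Nat.choose 5 j) *
          ({C | M.IsCircuit C ∧ C.ncard = 3}.ncard * M.E.ncard.choose 2 +
            {C | M.IsCircuit C ∧ C.ncard = 4}.ncard * M.E.ncard +
            {C | M.IsCircuit C ∧ C.ncard = 5}.ncard) := by
  classical
  set Ef := M.ground_finite.toFinset with hEf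
  have hE : (Ef : Set α) = M.E := Set.Finite.coe_toFinset _
  have hEcard : Ef.card = M.E.ncard := (Set.ncard_eq_toFinset_card _ M.ground_finite).symm
  set σ := ∑ j ∈ Finset.range (d - 5 + 1), Nat.choose 5 j with hσ
  set S := {B : Set α | B ⊆ M.E ∧ M.eRk B = 4 ∧ B.ncard ≤ d} with hS
  set S₁ := {B : Set α | B ⊆ (Ef : Set α) ∧ B.ncard = 4} with hS₁
  set S₂ := {B : Set α | B ⊆ M.E ∧ M.eRk B = 4 ∧ 4 < B.ncard ∧ B.ncard ≤ d} with hS₂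
  have hsplit : S ⊆ S₁ ∪ S₂ := by
    intro B hB
    have hBfin : B.Finite := M.ground_finite.subset hB.1
    have hle : 4 ≤ B.ncard := by
      have := M.eRk_le_encard B
      rw [hB.2.1, ← hBfin.cast_ncard_eq] at this
      exact_mod_cast this
    rcases hle.lt_or_eq with h | h
    · exact Or.inr ⟨hB.1, hB.2.1, h, hB.2.2⟩
    · exact Or.inl ⟨by rw [hE]; exact hB.1, h.symm⟩
  have hS₁fin : S₁.Finite := (Ef.finite_toSet.finite_subsets).subset (fun B hB => hB.1)
  have hS₂fin : S₂.Finite := M.ground_finite.finite_subsets.subset (fun B hB => hB.1)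
  have hS₁ : S₁.ncard = M.E.ncard.choose 4 := by
    rw [hS₁, ncard_subsets_ncard_eq Ef 4, hEcard]
  -- the circuits of each size, and the subsets of `E` of each size, as `Finset`s of `Set`s
  have hcircfin : ∀ k : ℕ, {C | M.IsCircuit C ∧ C.ncard = k}.Finite := fun k =>
    M.ground_finite.finite_subsets.subset (fun C hC => hC.1.subset_ground)
  set 𝒞 : ℕ → Finset (Set α) := fun k => (hcircfin k).toFinset with h𝒞
  set 𝓑 : ℕ → Finset (Set α) := fun j => (Ef.powersetCard j).image (fun s : Finset α => (s : Set α)) with h𝓑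
  have h𝓑card : ∀ j, (𝓑 j).card ≤ M.E.ncard.choose j := by
    intro j
    calc (𝓑 j).card ≤ (Ef.powersetCard j).card := Finset.card_image_le
      _ = Ef.card.choose j := Finset.card_powersetCard j Ef
      _ = M.E.ncard.choose j := by rw [hEcard]
  have h𝒞card : ∀ k, (𝒞 k).card = {C | M.IsCircuit C ∧ C.ncard = k}.ncard := fun k =>
    (Set.ncard_eq_toFinset_card _ (hcircfin k)).symm
  have hmem𝓑 : ∀ (j : ℕ) (B' : Set α), B' ⊆ M.E → B'.ncard = j → B' ∈ 𝓑 j := by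
    intro j B' hB'E hB'
    have hB'fin : B'.Finite := M.ground_finite.subset hB'E
    rw [h𝓑, Finset.mem_image]
    refine ⟨hB'fin.toFinset, ?_, by simp⟩
    rw [Finset.mem_powersetCard]
    refine ⟨?_, by rw [← Set.ncard_eq_toFinset_card B' hB'fin]; exact hB'⟩
    intro x hx
    rw [Set.Finite.mem_toFinset] at hx
    rw [hEf, Set.Finite.mem_toFinset]
    exact hB'E hx
  -- the pairs `(C, B')`: disjoint, `r(C ∪ B') ≤ 4`
  set P : Finset (Set α × Set α) :=
    ((𝒞 3 ×ˢ 𝓑 2) ∪ (𝒞 4 ×ˢ 𝓑 1) ∪ (𝒞 5 ×ˢ 𝓑 0)).filter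
      (fun p => Disjoint p.2 p.1 ∧ M.eRk (p.1 ∪ p.2) ≤ 4) with hP
  -- the fibres
  have hFibfin : ∀ p : Set α × Set α,
      {B : Set α | p.1 ∪ p.2 ⊆ B ∧ B ⊆ M.closure (p.1 ∪ p.2) ∧ B.ncard ≤ d}.Finite := fun p =>
    M.ground_finite.finite_subsets.subset (fun B hB => hB.2.1.trans (M.closure_subset_ground _))
  set Tf : Finset (Set α) := P.biUnion (fun p => (hFibfin p).toFinset) with hTf
  -- every `B ∈ S₂` lies in some fibre
  have hex : ∀ B ∈ S₂, ∃ p ∈ P, B ∈ (hFibfin p).toFinset := by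
    intro B hB
    obtain ⟨C, B', hC, hCB, hB'B, hdisj, hcard, hBcl⟩ :=
      exists_circuit_extension_exact hB.1 (q := 4) (by exact_mod_cast hB.2.1) hB.2.2.1
    have hCfin : C.Finite := M.ground_finite.subset hC.subset_ground
    have hC3 : 3 ≤ C.ncard := by
      have := hcirc C hC
      rw [← hCfin.cast_ncard_eq] at this
      exact_mod_cast this
    have hCmem : C ∈ 𝒞 C.ncard := by
      rw [h𝒞, Set.Finite.mem_toFinset]; exact ⟨hC, rfl⟩
    have hB'mem : B' ∈ 𝓑 (5 - C.ncard) := hmem𝓑 _ B' (hB'B.trans hB.1) (by omega)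
    have hrk : M.eRk (C ∪ B') ≤ 4 := by
      rw [← hB.2.1]; exact M.eRk_mono (union_subset hCB hB'B)
    refine ⟨(C, B'), ?_, ?_⟩
    · rw [hP, Finset.mem_filter]
      refine ⟨?_, hdisj, hrk⟩
      rw [Finset.mem_union, Finset.mem_union, Finset.mem_product, Finset.mem_product,
        Finset.mem_product]
      have h5 : C.ncard ≤ 5 := by omega
      interval_cases hk : C.ncard
      · exact Or.inl (Or.inl ⟨hCmem, hB'mem⟩)
      · exact Or.inl (Or.inr ⟨hCmem, hB'mem⟩)
      · exact Or.inr ⟨hCmem, hB'mem⟩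
    · rw [Set.Finite.mem_toFinset]
      exact ⟨union_subset hCB hB'B, hBcl, hB.2.2.2⟩
  have hS₂sub : S₂ ⊆ (Tf : Set (Set α)) := by
    intro B hB
    obtain ⟨p, hp, hBp⟩ := hex B hB
    rw [Finset.mem_coe, hTf, Finset.mem_biUnion]
    exact ⟨p, hp, hBp⟩
  -- each fibre has at most `σ` members
  have hfib : ∀ p ∈ P, ((hFibfin p).toFinset).card ≤ σ := by
    intro p hp
    rw [hP, Finset.mem_filter] at hp
    obtain ⟨hpmem, hdisj, hrk⟩ := hp
    have hkj : ∃ k j : ℕ, k + j = 5 ∧ p.1 ∈ 𝒞 k ∧ p.2 ∈ 𝓑 j := by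
      rw [Finset.mem_union, Finset.mem_union, Finset.mem_product, Finset.mem_product,
        Finset.mem_product] at hpmem
      rcases hpmem with (⟨h1, h2⟩ | ⟨h1, h2⟩) | ⟨h1, h2⟩
      · exact ⟨3, 2, rfl, h1, h2⟩
      · exact ⟨4, 1, rfl, h1, h2⟩
      · exact ⟨5, 0, rfl, h1, h2⟩
    obtain ⟨k, j, hkj5, h1, h2⟩ := hkj
    rw [h𝒞, Set.Finite.mem_toFinset] at h1
    rw [h𝓑, Finset.mem_image] at h2
    obtain ⟨s, hs, hs'⟩ := h2
    rw [Finset.mem_powersetCard] at hs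
    have hp1E : p.1 ⊆ M.E := h1.1.subset_ground
    have hp2E : p.2 ⊆ M.E := by rw [← hs', ← hE]; exact Finset.coe_subset.2 hs.1
    have hp1fin : p.1.Finite := M.ground_finite.subset hp1E
    have hp2fin : p.2.Finite := M.ground_finite.subset hp2E
    have hp1c : p.1.ncard = k := h1.2
    have hp2c : p.2.ncard = j := by rw [← hs', Set.ncard_coe_finset]; exact hs.2
    have hU5 : (p.1 ∪ p.2).ncard = 5 := by
      rw [ncard_union_eq hdisj.symm hp1fin hp2fin, hp1c, hp2c, hkj5]
    have hUE : p.1 ∪ p.2 ⊆ M.E := union_subset hp1E hp2E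
    have hFfin : (M.closure (p.1 ∪ p.2)).Finite :=
      M.ground_finite.subset (M.closure_subset_ground _)
    have hF10 : (M.closure (p.1 ∪ p.2)).ncard ≤ 10 :=
      hten _ (M.closure_subset_ground _) (by rw [M.eRk_closure_eq]; exact hrk)
    have hUF : p.1 ∪ p.2 ⊆ M.closure (p.1 ∪ p.2) := M.subset_closure _ hUE
    have hFU : (M.closure (p.1 ∪ p.2) \ (p.1 ∪ p.2)).ncard ≤ 5 := by
      rw [ncard_sdiff hUF (hFfin.subset hUF), hU5]
      omega
    rw [← Set.ncard_eq_toFinset_card _ (hFibfin p)]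
    exact ncard_fibre_le hFfin hU5 hFU d
  -- the number of pairs
  have hPcard : P.card ≤ {C | M.IsCircuit C ∧ C.ncard = 3}.ncard * M.E.ncard.choose 2 +
      {C | M.IsCircuit C ∧ C.ncard = 4}.ncard * M.E.ncard +
      {C | M.IsCircuit C ∧ C.ncard = 5}.ncard := by
    calc P.card ≤ ((𝒞 3 ×ˢ 𝓑 2) ∪ (𝒞 4 ×ˢ 𝓑 1) ∪ (𝒞 5 ×ˢ 𝓑 0)).card := Finset.card_filter_le _ _
      _ ≤ ((𝒞 3 ×ˢ 𝓑 2) ∪ (𝒞 4 ×ˢ 𝓑 1)).card + (𝒞 5 ×ˢ 𝓑 0).card := Finset.card_union_le _ _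
      _ ≤ (𝒞 3 ×ˢ 𝓑 2).card + (𝒞 4 ×ˢ 𝓑 1).card + (𝒞 5 ×ˢ 𝓑 0).card := by
          gcongr; exact Finset.card_union_le _ _
      _ = (𝒞 3).card * (𝓑 2).card + (𝒞 4).card * (𝓑 1).card + (𝒞 5).card * (𝓑 0).card := by
          rw [Finset.card_product, Finset.card_product, Finset.card_product]
      _ ≤ {C | M.IsCircuit C ∧ C.ncard = 3}.ncard * M.E.ncard.choose 2 +
          {C | M.IsCircuit C ∧ C.ncard = 4}.ncard * M.E.ncard +
          {C | M.IsCircuit C ∧ C.ncard = 5}.ncard := by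
          have h2 := h𝓑card 2
          have h1 := h𝓑card 1
          have h0 := h𝓑card 0
          rw [Nat.choose_one_right] at h1
          rw [Nat.choose_zero_right] at h0
          rw [h𝒞card 3, h𝒞card 4, h𝒞card 5]
          calc {C | M.IsCircuit C ∧ C.ncard = 3}.ncard * (𝓑 2).card +
                {C | M.IsCircuit C ∧ C.ncard = 4}.ncard * (𝓑 1).card +
                {C | M.IsCircuit C ∧ C.ncard = 5}.ncard * (𝓑 0).card
              ≤ {C | M.IsCircuit C ∧ C.ncard = 3}.ncard * M.E.ncard.choose 2 +
                {C | M.IsCircuit C ∧ C.ncard = 4}.ncard * M.E.ncard +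
                {C | M.IsCircuit C ∧ C.ncard = 5}.ncard * 1 := by gcongr
            _ = _ := by ring
  -- assemble
  have hTfcard : Tf.card ≤ σ * ({C | M.IsCircuit C ∧ C.ncard = 3}.ncard * M.E.ncard.choose 2 +
      {C | M.IsCircuit C ∧ C.ncard = 4}.ncard * M.E.ncard +
      {C | M.IsCircuit C ∧ C.ncard = 5}.ncard) := by
    calc Tf.card ≤ ∑ p ∈ P, ((hFibfin p).toFinset).card := Finset.card_biUnion_le
      _ ≤ ∑ _p ∈ P, σ := Finset.sum_le_sum hfib
      _ = P.card * σ := by rw [Finset.sum_const, smul_eq_mul]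
      _ ≤ _ := by rw [mul_comm]; exact Nat.mul_le_mul_left σ hPcard
  calc S.ncard ≤ (S₁ ∪ S₂).ncard := ncard_le_ncard hsplit (hS₁fin.union hS₂fin)
    _ ≤ S₁.ncard + S₂.ncard := ncard_union_le _ _
    _ ≤ M.E.ncard.choose 4 + Tf.card := by
        rw [hS₁]
        gcongr
        rw [← Set.ncard_coe_finset]
        exact ncard_le_ncard hS₂sub Tf.finite_toSet
    _ ≤ _ := by gcongr

end Matroid

end PercRepro
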